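import Mathlib
import Summits.MatrixMultiplication.MatrixMultiplication.Theorems.FourierTwoFamiliesModPPrimeCyclicPowerGainThetaCliqueCover

/-!
# Translated-rectangle clique cover for theta-body kernels on block pairs

Crux `stmt-MatrixMultiplication-14310` (`FourierTwoFamiliesModP.PrimeLogDecay`), line
`fixed-delta-theta-certificate`; proves the registered milestone stub `stub_thetaRectangleCover`
(supports the crux item; the lead composes it with `stub_intervalCoverage` into `stub_thetaIntervalBound`).

Setting: a finite additive commutative group `G`, vertices `v = (v.1, v.2)` ("block pairs") in
`V := Finset G × Finset G`, a forbidden difference set `X₀ : Finset G`, a "rectangle" `P − Q ⊆ X₀`, and a kernel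
`B : V → V → ℝ` that is symmetric, positive semidefinite as a real quadratic form, entrywise nonnegative, and whose
nonzero entries sit on pairs of vertices that are EQUAL or COMPATIBLE (both cross-difference sets `v.1 − w.2`,
`w.1 − v.2` avoid `X₀`).

Claim (`sq_mul_value_le_of_rectangleCover`, `stub_thetaRectangleCover`): if every vertex `v` of the diagonal
support `{v : B v v ≠ 0}` meets between `m ≥ 1` and `M` of the translated rectangles — the number of `t : G` with
`v.1 ∩ (t +ᵥ P) ≠ ∅` and `v.2 ∩ (t +ᵥ Q) ≠ ∅` lies in `[m, M]` — then
`m² · Σ_{v,w} B v w ≤ M · |G| · Σ_v B v v`.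

Proof.  For every `t : G` the vertices meeting the translated rectangle,
`C t := {v : v.1 ∩ (t +ᵥ P) ≠ ∅ ∧ v.2 ∩ (t +ᵥ Q) ≠ ∅}`, form a clique in the kernel sense
(`entry_eq_zero_of_vadd_rectangle`: the landed `Rectangle.entry_eq_zero_of_rectangle` of `…ThetaRectangle` at
the translated rectangle, re-proved here in six lines to keep the import closure small; note
`(t +ᵥ P) − (t +ᵥ Q) = P − Q ⊆ X₀`, `vadd_finset_sub_vadd_finset`).
Feed the `|G|` cliques `C t` with weights `y t := 1/m` and multiplicity bound `μ := M/m` to the fractional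
clique-cover bound `CliqueCover.value_le_of_cliqueCover`: the cover multiplicity of `v` is
`#{t : v ∈ C t} / m ∈ [1, M/m]` on the diagonal support, so `Σ B ≤ (M/m) · (|G|/m) · tr B`; multiply by `m² > 0`.
-/

namespace Summit.MatrixMultiplication.MatrixMultiplication.Theorems.PrimeLogDecayTheta.RectangleCover

open Finset
open scoped Pointwise BigOperators
open Summit.MatrixMultiplication.MatrixMultiplication.Theorems.PrimeCyclicPowerGainTheta

/-- Translating both finsets by the same group element does not change their difference set:
`(t +ᵥ P) − (t +ᵥ Q) = P − Q`. -/
theorem vadd_finset_sub_vadd_finset {G : Type*} [AddCommGroup G] [DecidableEq G] (t : G)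
    (P Q : Finset G) : (t +ᵥ P) - (t +ᵥ Q) = P - Q := by
  ext x
  simp only [Finset.mem_sub, Finset.mem_vadd_finset]
  constructor
  · rintro ⟨_, ⟨a, ha, rfl⟩, _, ⟨b, hb, rfl⟩, rfl⟩
    exact ⟨a, ha, b, hb, by simp only [vadd_eq_add]; abel⟩
  · rintro ⟨a, ha, b, hb, rfl⟩
    exact ⟨t +ᵥ a, ⟨a, ha, rfl⟩, t +ᵥ b, ⟨b, hb, rfl⟩, by simp only [vadd_eq_add]; abel⟩

/-- **Translated rectangle clique, kernel form** (the landed `Rectangle.entry_eq_zero_of_rectangle` of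
`…ThetaRectangle` at the rectangle `(t +ᵥ P, t +ᵥ Q)`, re-proved inline).  If `P − Q ⊆ X₀` and the nonzero
entries of `B` sit on equal-or-compatible pairs, then `B v w = 0` for two DISTINCT vertices with
`v.1 ∩ (t +ᵥ P) ≠ ∅` and `w.2 ∩ (t +ᵥ Q) ≠ ∅`: elements `t + a ∈ v.1` (`a ∈ P`) and `t + b ∈ w.2` (`b ∈ Q`) give
`a − b ∈ (v.1 − w.2) ∩ X₀`, contradicting compatibility. -/
theorem entry_eq_zero_of_vadd_rectangle {G : Type*} [AddCommGroup G] [DecidableEq G] (X₀ P Q : Finset G)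
    (hPQ : P - Q ⊆ X₀) (B : Finset G × Finset G → Finset G × Finset G → ℝ)
    (hsupp : ∀ v w : Finset G × Finset G, B v w ≠ 0 →
      v = w ∨ (Disjoint (v.1 - w.2) X₀ ∧ Disjoint (w.1 - v.2) X₀))
    (t : G) (v w : Finset G × Finset G) (hvw : v ≠ w) (hv : (v.1 ∩ (t +ᵥ P)).Nonempty)
    (hw : (w.2 ∩ (t +ᵥ Q)).Nonempty) : B v w = 0 := by
  by_contra hB
  rcases hsupp v w hB with h | ⟨hdis, _⟩
  · exact hvw h
  · obtain ⟨x, hx⟩ := hv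
    obtain ⟨y, hy⟩ := hw
    rw [Finset.mem_inter] at hx hy
    have hxy : x - y ∈ P - Q := by
      rw [← vadd_finset_sub_vadd_finset t P Q]
      exact Finset.sub_mem_sub hx.2 hy.2
    exact Finset.disjoint_left.1 hdis (Finset.sub_mem_sub hx.1 hy.1) (hPQ hxy)

/-- **Translated-rectangle clique cover** (named-hypothesis form of `stub_thetaRectangleCover`).  `G` a finite
additive commutative group, `P − Q ⊆ X₀` a rectangle, `B` a symmetric PSD entrywise-nonnegative kernel on block
pairs whose nonzero entries sit on equal-or-compatible pairs.  If every vertex of the diagonal support meets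
between `m ≥ 1` and `M` of the translated rectangles `(t +ᵥ P, t +ᵥ Q)`, then
`m² · Σ_{v,w} B v w ≤ M · |G| · Σ_v B v v`. -/
theorem sq_mul_value_le_of_rectangleCover {G : Type*} [AddCommGroup G] [Fintype G] [DecidableEq G]
    (X₀ P Q : Finset G) (B : Finset G × Finset G → Finset G × Finset G → ℝ) (m M : ℕ) (hm : 0 < m)
    (hPQ : P - Q ⊆ X₀)
    (hsymm : ∀ v w, B v w = B w v)
    (hpsd : ∀ x : Finset G × Finset G → ℝ, 0 ≤ ∑ v, ∑ w, x v * B v w * x w)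
    (hnn : ∀ v w, 0 ≤ B v w)
    (hsupp : ∀ v w : Finset G × Finset G, B v w ≠ 0 →
      v = w ∨ (Disjoint (v.1 - w.2) X₀ ∧ Disjoint (w.1 - v.2) X₀))
    (hlow : ∀ v : Finset G × Finset G, B v v ≠ 0 →
      m ≤ (Finset.univ.filter fun t : G =>
            (v.1 ∩ (t +ᵥ P)).Nonempty ∧ (v.2 ∩ (t +ᵥ Q)).Nonempty).card)
    (hupp : ∀ v : Finset G × Finset G, B v v ≠ 0 →
      (Finset.univ.filter fun t : G =>
            (v.1 ∩ (t +ᵥ P)).Nonempty ∧ (v.2 ∩ (t +ᵥ Q)).Nonempty).card ≤ M) :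
    (m : ℝ) ^ 2 * ∑ v, ∑ w, B v w ≤ (M : ℝ) * (Fintype.card G : ℝ) * ∑ v, B v v := by
  -- the translated-rectangle cliques
  set C : G → Finset (Finset G × Finset G) := fun t =>
    Finset.univ.filter fun v : Finset G × Finset G =>
      (v.1 ∩ (t +ᵥ P)).Nonempty ∧ (v.2 ∩ (t +ᵥ Q)).Nonempty with hC
  have hmpos : (0 : ℝ) < m := Nat.cast_pos.2 hm
  have hmem : ∀ t v, v ∈ C t ↔ (v.1 ∩ (t +ᵥ P)).Nonempty ∧ (v.2 ∩ (t +ᵥ Q)).Nonempty := by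
    intro t v
    simp only [hC, Finset.mem_filter, Finset.mem_univ, true_and]
  -- each `C t` is a clique in the kernel sense
  have hclique : ∀ t, ∀ v ∈ C t, ∀ w ∈ C t, v ≠ w → B v w = 0 := by
    intro t v hv w hw hvw
    rw [hmem] at hv hw
    exact entry_eq_zero_of_vadd_rectangle X₀ P Q hPQ B hsupp t v w hvw hv.1 hw.2
  -- the cover multiplicity of `v` is `#{t : v ∈ C t} / m`
  have hY : ∀ v : Finset G × Finset G,
      (∑ t, if v ∈ C t then 1 / (m : ℝ) else 0) =
        ((Finset.univ.filter fun t : G =>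
            (v.1 ∩ (t +ᵥ P)).Nonempty ∧ (v.2 ∩ (t +ᵥ Q)).Nonempty).card : ℝ) / m := by
    intro v
    have hfilter : (Finset.univ.filter fun t => v ∈ C t) =
        Finset.univ.filter fun t : G => (v.1 ∩ (t +ᵥ P)).Nonempty ∧ (v.2 ∩ (t +ᵥ Q)).Nonempty :=
      Finset.filter_congr fun t _ => hmem t v
    rw [Finset.sum_ite, Finset.sum_const_zero, add_zero, Finset.sum_const, nsmul_eq_mul, hfilter]
    ring
  have hcov : ∀ v, B v v ≠ 0 → 1 ≤ ∑ t, if v ∈ C t then 1 / (m : ℝ) else 0 := by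
    intro v hv
    rw [hY v, le_div_iff₀ hmpos, one_mul]
    exact_mod_cast hlow v hv
  have hmult : ∀ v, B v v ≠ 0 → (∑ t, if v ∈ C t then 1 / (m : ℝ) else 0) ≤ (M : ℝ) / m := by
    intro v hv
    rw [hY v]
    exact div_le_div_of_nonneg_right (by exact_mod_cast hupp v hv) hmpos.le
  -- the fractional clique-cover bound, `Σ B ≤ (M/m) · (|G|/m) · tr B`
  have key : ∑ v, ∑ w, B v w ≤ (M : ℝ) / m * (∑ _t : G, 1 / (m : ℝ)) * ∑ v, B v v :=
    CliqueCover.value_le_of_cliqueCover B C (fun _ => 1 / (m : ℝ)) ((M : ℝ) / m) hsymm hpsd hnn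
      (fun _ => by positivity) hclique hcov hmult
  have e : (M : ℝ) / m * (∑ _t : G, 1 / (m : ℝ)) * ∑ v, B v v =
      (M : ℝ) * (Fintype.card G : ℝ) * (∑ v, B v v) / (m : ℝ) ^ 2 := by
    rw [Finset.sum_const, Finset.card_univ, nsmul_eq_mul]
    ring
  rw [e, le_div_iff₀ (pow_pos hmpos 2)] at key
  calc (m : ℝ) ^ 2 * ∑ v, ∑ w, B v w = (∑ v, ∑ w, B v w) * (m : ℝ) ^ 2 := mul_comm _ _
    _ ≤ (M : ℝ) * (Fintype.card G : ℝ) * ∑ v, B v v := key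

/-- **Registered milestone stub `stub_thetaRectangleCover`** (crux stmt-MatrixMultiplication-14310, line
fixed-delta-theta-certificate): translated-rectangle clique cover.  Finite abelian `G`, a rectangle
`P − Q ⊆ X₀`, a symmetric PSD entrywise-nonnegative kernel `B` on block pairs whose nonzero entries sit on
equal-or-compatible pairs.  If every vertex `v` of the diagonal support meets between `m ≥ 1` and `M` of the
translated rectangles — i.e. the number of `t : G` with `v.1 ∩ (t +ᵥ P) ≠ ∅` and `v.2 ∩ (t +ᵥ Q) ≠ ∅` lies in
`[m, M]` — then `m² · Σ_{v,w} B v w ≤ M · |G| · Σ_v B v v`. -/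
theorem stub_thetaRectangleCover :
    ∀ (G : Type) [AddCommGroup G] [Fintype G] [DecidableEq G] (X₀ P Q : Finset G)
      (B : Finset G × Finset G → Finset G × Finset G → ℝ) (m M : ℕ), 0 < m →
      P - Q ⊆ X₀ →
      (∀ v w, B v w = B w v) →
      (∀ x : Finset G × Finset G → ℝ, 0 ≤ ∑ v, ∑ w, x v * B v w * x w) →
      (∀ v w, 0 ≤ B v w) →
      (∀ v w : Finset G × Finset G, B v w ≠ 0 →
        v = w ∨ (Disjoint (v.1 - w.2) X₀ ∧ Disjoint (w.1 - v.2) X₀)) →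
      (∀ v : Finset G × Finset G, B v v ≠ 0 →
        m ≤ (Finset.univ.filter fun t : G =>
              (v.1 ∩ (t +ᵥ P)).Nonempty ∧ (v.2 ∩ (t +ᵥ Q)).Nonempty).card) →
      (∀ v : Finset G × Finset G, B v v ≠ 0 →
        (Finset.univ.filter fun t : G =>
              (v.1 ∩ (t +ᵥ P)).Nonempty ∧ (v.2 ∩ (t +ᵥ Q)).Nonempty).card ≤ M) →
      (m : ℝ) ^ 2 * ∑ v, ∑ w, B v w ≤ (M : ℝ) * (Fintype.card G : ℝ) * ∑ v, B v v :=
  fun _ _ _ _ X₀ P Q B m M hm hPQ hsymm hpsd hnn hsupp hlow hupp =>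
    sq_mul_value_le_of_rectangleCover X₀ P Q B m M hm hPQ hsymm hpsd hnn hsupp hlow hupp

end Summit.MatrixMultiplication.MatrixMultiplication.Theorems.PrimeLogDecayTheta.RectangleCover
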